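import Literature.Analysis.PDE.SymmHyperbolicSmoothFamiliesOfDim4
import HarnessLib

/-!
# `[X_d]` for every `d` and the smooth-families fact on `𝕋³`, PROVED (topic `Analysis/PDE`)

Analysis/PDE proof file (theorems only; no definitions, no named facts). Closes two
named facts of the tree BY NAME:

* `SymmHyperbolicLocalExistenceDim d` (`[X_d]`, statement file `SymmHyperbolicLocalExistenceDim`:
  single-datum local `C^∞` existence for quasilinear symmetric hyperbolic systems on `𝕋ᵈ`, matrix
  language, general symmetric positive definite symmetriser; Kato 1975 Thm II, Majda 1984 Thm 2.1,
  Rendall 2008 §8.3) — for EVERY `d`: `symmHyperbolicLocalExistenceDim_of_dim d` is literally the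
  tree theorem `symmHyperbolicLocalExistence_matrix_dim d` (`TorusSymmHyperbolicLocalExistence`),
  i.e. Majda's energy method re-typed on `𝕋ᵈ` (`IsQLSymmCoeff.exists_smooth_solution_of_wordSup`,
  Sobolev margin `σ = d + 1`, word-form sup embedding `Torus.wordSupEmbedding_fin`; files
  `TorusQuasilinearAPriori` / `Scheme` / `Limit`, `FunctionSpaces/TorusWordSupEmbedding`). The rung
  `d = 3` was `symmHyperbolicLocalExistenceDim_three`; the rung `d = 4` is
  `symmHyperbolicLocalExistenceDim_four`.
* `symmHyperbolic_smoothFamilies` (statement file `SymmHyperbolicSmoothFamilies`: smooth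
  one-parameter FAMILIES on `𝕋³`, common life span, joint smoothness; Kato 1975 Thms II–III with the
  parameter principle, Valiente Kroon 2016 Thm 12.4, Hörmander 1997 §4.2 p. 54) —
  `symmHyperbolic_smoothFamilies_holds`, by the PROVED ParameterAsDimension door
  `symmHyperbolic_smoothFamilies_of_dim4` (`SymmHyperbolicSmoothFamiliesOfDim4`: parameter as a
  fourth space variable on `𝕋⁴ = 𝕋³ × 𝕋¹`) applied to `[X₄]`.

Consequences elsewhere (one-liners, not in this file): the hard-sphere family fact
`Literature.MathematicalPhysics.KineticTheory.hsEuler_smoothFamilyWellposedness`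
(`hsEuler_smoothFamilyWellposedness_of_symmHyperbolic`), and the route statement
`Summit.AtomisticToContinuum.HydrodynamicLimit.Theses.OneSphereInfluence.PreShockHomotopy`
(`Theorems.PreShockDoor.preShockHomotopy_of_dim4 symmHyperbolicLocalExistenceDim_four`).

## Mathlib / tree search

Tree: `SymmHyperbolicLocalExistenceDim`, `symmHyperbolicLocalExistenceDim_three`
(`SymmHyperbolicLocalExistenceDim`); `symmHyperbolicLocalExistence_matrix_dim`
(`TorusSymmHyperbolicLocalExistence`); `symmHyperbolic_smoothFamilies`
(`SymmHyperbolicSmoothFamilies`); `symmHyperbolic_smoothFamilies_of_dim4`,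
`parameterAsDimension_ladder` (`SymmHyperbolicSmoothFamiliesOfDim4`). The three names declared
here are fresh (`lean search --decl`, `rg` over the tree: no matches).

## References

* T. Kato, *The Cauchy problem for quasi-linear symmetric hyperbolic systems*, Arch. Rational
  Mech. Anal. 58 (1975) 181–205, Thms II–III. [`Kato1975`]
* A. Majda, *Compressible Fluid Flow and Systems of Conservation Laws in Several Space
  Variables*, Springer 1984, Ch. 2 §2.1, Thm 2.1. [`Majda1984`]
* A. D. Rendall, *Partial Differential Equations in General Relativity*, OUP 2008, §8.3
  pp. 178–183. [`Rendall2008`]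
* J. A. Valiente Kroon, *Conformal Methods in General Relativity*, CUP 2016, §12.3, Thm 12.4.
  [`Kroon2016`]
* L. Hörmander, *Lectures on Nonlinear Hyperbolic Differential Equations*, Springer 1997, §4.2
  p. 54. [`Hormander1997`]
-/

noncomputable section

open Set Filter Function Matrix Metric
open scoped ContDiff Topology

namespace Literature.Analysis.PDE

open Literature.Analysis.FunctionSpaces Literature.Analysis.FunctionSpaces.Torus

/-! ## [X_d] for every `d` -/

/-- **[X_d] for EVERY `d` (PROVED).** Single-datum local `C^∞` existence for quasilinear symmetric
hyperbolic systems `A₀(V)∂ₜV + ∑_{k<d} A_k(V)∂_kV = 0` on the flat torus `𝕋ᵈ`, general symmetric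
positive definite symmetriser, data with compact range in the open coefficient domain — the named
fact `SymmHyperbolicLocalExistenceDim d` is, literally, the tree theorem
`symmHyperbolicLocalExistence_matrix_dim d` (`TorusSymmHyperbolicLocalExistence`: Majda's energy
method on `𝕋ᵈ` in the `C^∞` class at the Sobolev margin `σ = d + 1`, word-form sup embedding
`Torus.wordSupEmbedding_fin`). Supersedes the «ABSENT for `d ≠ 3`» clause of the statement file.
[cite: Kato1975, Thm II] [cite: Majda1984, Ch. 2 §2.1, Thm 2.1]
[cite: Rendall2008, §8.3 pp. 178–183] -/
theorem symmHyperbolicLocalExistenceDim_of_dim (d : ℕ) : SymmHyperbolicLocalExistenceDim d :=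
  fun N O A₀ A hO hA0 hA hPD hSy V₀ hV₀ hK =>
    symmHyperbolicLocalExistence_matrix_dim d N O A₀ A hO hA0 hA hPD hSy V₀ hV₀ hK

/-- **[X₄]** — the rung `d = 4`, the input of the ParameterAsDimension door
`symmHyperbolic_smoothFamilies_of_dim4`.
[cite: Kato1975, Thm II] [cite: Majda1984, Ch. 2 §2.1, Thm 2.1] -/
theorem symmHyperbolicLocalExistenceDim_four : SymmHyperbolicLocalExistenceDim 4 :=
  symmHyperbolicLocalExistenceDim_of_dim 4

/-! ## The smooth-families fact on `𝕋³` is a theorem -/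

/-- **`symmHyperbolic_smoothFamilies` (PROVED)** — smooth one-parameter families of local classical
solutions of quasilinear symmetric hyperbolic systems on `𝕋³` with a common life span and joint
smoothness in (parameter, time, space) (Kato 1975 Thms II–III in the compact-section form, with the
parameter principle): the PROVED door `symmHyperbolic_smoothFamilies_of_dim4` (parameter as a fourth
space variable) applied to `[X₄]`. The named fact of `SymmHyperbolicSmoothFamilies` thereby holds.
[cite: Kato1975, Thms II–III] [cite: Kroon2016, Thm 12.4] [cite: Hormander1997, §4.2 p. 54] -/
theorem symmHyperbolic_smoothFamilies_holds : symmHyperbolic_smoothFamilies :=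
  symmHyperbolic_smoothFamilies_of_dim4 symmHyperbolicLocalExistenceDim_four

end Literature.Analysis.PDE

end
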